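import Literature.Topology.FourManifolds.TautFoliationsContourChart
import Literature.Topology.FourManifolds.TautFoliationsContourSquareFloor
import HarnessLib

/-!
# Contour charts of the cone of a square: all four sectors by symmetry

Topic: sequel to `TautFoliationsContourChart.lean`. The bottom-right contour chart `brChart` is
transported to the other three sectors of the punctured square by the **symmetries of the
square** (rotations by right angles about the centre, isometries of the max norm commuting
with the cone coordinates):

* `ConeSquare.IsSquareSymmetry` (**definition**): a homeomorphism of the plane fixing the
  centre, preserving the distance to the centre and commuting with the radial projection off
  the centre; `isSquareSymmetry_refl`, `IsSquareSymmetry.trans`, and the right-angle rotation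
  `ConeSquare.rot c` (`isSquareSymmetry_rot`);
* `coneHt_symm` (**proved**): `coneHt (ψ ∘ T⁻¹) (T x) = coneHt ψ x`;
* `ConeSquare.sectorChart T` (**definition**): `T` followed by the bottom-right chart for the
  transported boundary heights `ψ ∘ T⁻¹`; its height coordinate is still the cone height
  (`sectorChart_snd`), its source is `T ⁻¹' brSector`;
* `exists_mem_sectorChart_source` (**proved**): **the four charts `sectorChart (rot^k)`,
  `k < 4`, cover the punctured open square.**

All statements are [folklore].
-/

noncomputable section

open Set Filter Metric Topology

namespace Literature.Topology.FourManifolds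

namespace ConeSquare

variable {c : ℝ × ℝ} {ℓ m : ℝ} {ψ : ℝ × ℝ → ℝ} {x q : ℝ × ℝ}

/-! ## Symmetries of the square -/

/-- A **symmetry of the square** of centre `c`: a homeomorphism of the plane fixing `c`,
preserving the distance to `c`, and commuting with the radial projection off the centre.
[folklore] -/
structure IsSquareSymmetry (c : ℝ × ℝ) (ℓ : ℝ) (T : (ℝ × ℝ) ≃ₜ (ℝ × ℝ)) : Prop where
  map_center : T c = c
  dist_eq : ∀ x, dist (T x) c = dist x c
  proj_eq : ∀ x, x ≠ c → proj c ℓ (T x) = T (proj c ℓ x)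

/-- The identity is a symmetry. [folklore] -/
theorem isSquareSymmetry_refl (c : ℝ × ℝ) (ℓ : ℝ) : IsSquareSymmetry c ℓ (Homeomorph.refl (ℝ × ℝ)) :=
  ⟨rfl, fun _ ↦ rfl, fun _ _ ↦ rfl⟩

namespace IsSquareSymmetry

variable {T T' : (ℝ × ℝ) ≃ₜ (ℝ × ℝ)}

/-- A symmetry maps points off the centre off the centre. [folklore] -/
theorem ne_center (hT : IsSquareSymmetry c ℓ T) (hx : x ≠ c) : T x ≠ c := fun h ↦ by
  have := hT.dist_eq x
  rw [h, dist_self] at this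
  exact hx (dist_eq_zero.1 this.symm)

/-- Symmetries compose. [folklore] -/
theorem trans (hT : IsSquareSymmetry c ℓ T) (hT' : IsSquareSymmetry c ℓ T') : IsSquareSymmetry c ℓ (T.trans T') := by
  refine ⟨?_, fun x ↦ ?_, fun x hx ↦ ?_⟩
  · show T' (T c) = c; rw [hT.map_center, hT'.map_center]
  · show dist (T' (T x)) c = dist x c; rw [hT'.dist_eq, hT.dist_eq]
  · show proj c ℓ (T' (T x)) = T' (T (proj c ℓ x))
    rw [hT'.proj_eq _ (hT.ne_center hx), hT.proj_eq _ hx]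

/-- A symmetry preserves the radial coordinate. [folklore] -/
theorem radial_eq (hT : IsSquareSymmetry c ℓ T) (x : ℝ × ℝ) : radial c ℓ (T x) = radial c ℓ x := by
  rw [radial_def, radial_def, hT.dist_eq]

/-- A symmetry preserves the boundary of the square. [folklore] -/
theorem mem_sphere_iff (hT : IsSquareSymmetry c ℓ T) : T x ∈ sphere c ℓ ↔ x ∈ sphere c ℓ := by
  rw [mem_sphere, mem_sphere, hT.dist_eq]

/-- A symmetry preserves the open square. [folklore] -/
theorem mem_ball_iff (hT : IsSquareSymmetry c ℓ T) : T x ∈ ball c ℓ ↔ x ∈ ball c ℓ := by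
  rw [mem_ball, mem_ball, hT.dist_eq]

/-- The inverse of a symmetry preserves the boundary. [folklore] -/
theorem symm_mem_sphere (hT : IsSquareSymmetry c ℓ T) (hq : q ∈ sphere c ℓ) : T.symm q ∈ sphere c ℓ := by
  rw [← hT.mem_sphere_iff, T.apply_symm_apply]; exact hq

/-- **The cone height is invariant**: transporting the boundary heights by `T` and the point
by `T` gives the same height. [folklore] -/
theorem coneHt_eq (hT : IsSquareSymmetry c ℓ T) (m : ℝ) (ψ : ℝ × ℝ → ℝ) (x : ℝ × ℝ) :
    coneHt c ℓ m (fun y ↦ ψ (T.symm y)) (T x) = coneHt c ℓ m ψ x := by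
  by_cases hx : x = c
  · subst hx
    rw [hT.map_center, coneHt_center, coneHt_center]
  · rw [coneHt_apply, coneHt_apply, hT.radial_eq, hT.proj_eq _ hx, T.symm_apply_apply]

/-- Transported boundary heights stay below the apex. [folklore] -/
theorem forall_lt_apex (hT : IsSquareSymmetry c ℓ T) (hm : ∀ q ∈ sphere c ℓ, ψ q < m) :
    ∀ q ∈ sphere c ℓ, (fun y ↦ ψ (T.symm y)) q < m := fun _ hq ↦ hm _ (hT.symm_mem_sphere hq)

/-- Transported boundary heights are continuous on the boundary. [folklore] -/
theorem continuousOn_comp_symm (hT : IsSquareSymmetry c ℓ T) (hψ : ContinuousOn ψ (sphere c ℓ)) :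
    ContinuousOn (fun y ↦ ψ (T.symm y)) (sphere c ℓ) :=
  hψ.comp T.symm.continuous.continuousOn fun _ hq ↦ hT.symm_mem_sphere hq

end IsSquareSymmetry

/-! ## The right-angle rotation about the centre -/

/-- The rotation by a right angle about `c`: `c + (u, v) ↦ c + (-v, u)`. [folklore] -/
def rot (c : ℝ × ℝ) : (ℝ × ℝ) ≃ₜ (ℝ × ℝ) where
  toFun p := (c.1 - (p.2 - c.2), c.2 + (p.1 - c.1))
  invFun p := (c.1 + (p.2 - c.2), c.2 - (p.1 - c.1))
  left_inv p := by ext <;> simp only <;> ring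
  right_inv p := by ext <;> simp only <;> ring
  continuous_toFun := by fun_prop
  continuous_invFun := by fun_prop

/-- The formula for `rot`. [folklore] -/
theorem rot_apply (c p : ℝ × ℝ) : rot c p = (c.1 - (p.2 - c.2), c.2 + (p.1 - c.1)) := rfl

/-- `rot` is an isometry of the max norm about `c`. [folklore] -/
theorem dist_rot (c x : ℝ × ℝ) : dist (rot c x) c = dist x c := by
  rw [Prod.dist_eq, Prod.dist_eq, rot_apply, Real.dist_eq, Real.dist_eq, Real.dist_eq, Real.dist_eq]
  simp only
  rw [show c.1 - (x.2 - c.2) - c.1 = -(x.2 - c.2) by ring, abs_neg, show c.2 + (x.1 - c.1) - c.2 = x.1 - c.1 by ring,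
    max_comm]

/-- **The right-angle rotation is a symmetry of the square.** [folklore] -/
theorem isSquareSymmetry_rot (c : ℝ × ℝ) (ℓ : ℝ) : IsSquareSymmetry c ℓ (rot c) := by
  refine ⟨by rw [rot_apply]; ext <;> simp, dist_rot c, fun x hx ↦ ?_⟩
  have hx' : rot c x ≠ c := fun h ↦ by
    have := dist_rot c x; rw [h, dist_self] at this; exact hx (dist_eq_zero.1 this.symm)
  rw [proj_of_ne hx', proj_of_ne hx, dist_rot, rot_apply, rot_apply]
  ext
  · simp only [Prod.fst_add, Prod.smul_fst, Prod.fst_sub, smul_eq_mul, Prod.snd_add, Prod.smul_snd, Prod.snd_sub]; ring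
  · simp only [Prod.fst_add, Prod.smul_fst, Prod.fst_sub, smul_eq_mul, Prod.snd_add, Prod.smul_snd, Prod.snd_sub]; ring

/-! ## The sector charts -/

section Charts

variable (hℓ : 0 < ℓ) (hm : ∀ q ∈ sphere c ℓ, ψ q < m) (hψ : ContinuousOn ψ (sphere c ℓ))
variable {T : (ℝ × ℝ) ≃ₜ (ℝ × ℝ)}

/-- **The contour chart of the sector `T ⁻¹ (bottom-right sector)`**: `T` followed by the
bottom-right chart of the transported boundary heights. [folklore] -/
def sectorChart (c : ℝ × ℝ) (ℓ m : ℝ) (ψ : ℝ × ℝ → ℝ) (hℓ : 0 < ℓ) (hm : ∀ q ∈ sphere c ℓ, ψ q < m)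
    (hψ : ContinuousOn ψ (sphere c ℓ)) (T : (ℝ × ℝ) ≃ₜ (ℝ × ℝ)) (hT : IsSquareSymmetry c ℓ T) :
    OpenPartialHomeomorph (ℝ × ℝ) (ℝ × ℝ) :=
  T.toOpenPartialHomeomorph.trans
    (brChart c ℓ m (fun y ↦ ψ (T.symm y)) hℓ (hT.forall_lt_apex hm) (hT.continuousOn_comp_symm hψ))

/-- The source of a sector chart is the preimage of the bottom-right sector. [folklore] -/
theorem sectorChart_source (hT : IsSquareSymmetry c ℓ T) :
    (sectorChart c ℓ m ψ hℓ hm hψ T hT).source = T ⁻¹' brSector c ℓ := by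
  rw [sectorChart, OpenPartialHomeomorph.trans_source, Homeomorph.toOpenPartialHomeomorph_source, univ_inter]; rfl

/-- **The height coordinate of a sector chart is the cone height.** [folklore] -/
theorem sectorChart_snd (hT : IsSquareSymmetry c ℓ T) (x : ℝ × ℝ) :
    (sectorChart c ℓ m ψ hℓ hm hψ T hT x).2 = coneHt c ℓ m ψ x := by
  show (brChart c ℓ m (fun y ↦ ψ (T.symm y)) hℓ (hT.forall_lt_apex hm) (hT.continuousOn_comp_symm hψ) (T x)).2 = _
  rw [brChart_snd, hT.coneHt_eq]

/-- Membership in the source of a sector chart. [folklore] -/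
theorem mem_sectorChart_source_iff (hT : IsSquareSymmetry c ℓ T) :
    x ∈ (sectorChart c ℓ m ψ hℓ hm hψ T hT).source ↔
      x ∈ ball c ℓ ∧ x ≠ c ∧ c.1 - c.2 < (T (proj c ℓ x)).1 - (T (proj c ℓ x)).2 := by
  rw [sectorChart_source, mem_preimage]
  constructor
  · rintro ⟨hb, hc, harc⟩
    have hx : x ≠ c := fun h ↦ hc (by rw [h, hT.map_center])
    refine ⟨hT.mem_ball_iff.1 hb, hx, ?_⟩
    rwa [hT.proj_eq _ hx] at harc
  · rintro ⟨hb, hx, harc⟩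
    refine ⟨hT.mem_ball_iff.2 hb, hT.ne_center hx, ?_⟩
    rwa [hT.proj_eq _ hx]

/-- The `k`-fold rotation is a symmetry. [folklore] -/
theorem isSquareSymmetry_rot_iterate (c : ℝ × ℝ) (ℓ : ℝ) :
    ∀ k : ℕ, IsSquareSymmetry c ℓ (Nat.iterate (fun S : (ℝ × ℝ) ≃ₜ (ℝ × ℝ) ↦ S.trans (rot c)) k (Homeomorph.refl _))
  | 0 => isSquareSymmetry_refl c ℓ
  | k + 1 => by
    rw [Function.iterate_succ_apply']
    exact (isSquareSymmetry_rot_iterate c ℓ k).trans (isSquareSymmetry_rot c ℓ)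

/-- **The four sectors cover the punctured open square**: for every point of `Q° ∖ {c}` one of
the four strict inequalities `±((q.1 - c.1) - (q.2 - c.2)) > 0`, `±((q.1 - c.1) + (q.2 - c.2)) > 0`
holds at `q = proj x` (else `q = c`), i.e. `x` lies in the source of the sector chart of one of
the rotations `rot^k`, `k < 4`. [folklore] -/
theorem exists_mem_sectorChart_source (hℓ : 0 < ℓ) (hm : ∀ q ∈ sphere c ℓ, ψ q < m) (hψ : ContinuousOn ψ (sphere c ℓ))
    (hxb : x ∈ ball c ℓ) (hxc : x ≠ c) :
    ∃ k < 4, x ∈ (sectorChart c ℓ m ψ hℓ hm hψ _ (isSquareSymmetry_rot_iterate c ℓ k)).source := by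
  set q := proj c ℓ x with hq
  have hqs : q ∈ sphere c ℓ := proj_mem_sphere hℓ x
  have hqc : q ≠ c := by
    intro h; rw [mem_sphere, h, dist_self] at hqs; exact hℓ.ne' hqs.symm
  -- the four rotated inequalities
  have e0 : (Nat.iterate (fun S : (ℝ × ℝ) ≃ₜ (ℝ × ℝ) ↦ S.trans (rot c)) 0 (Homeomorph.refl _)) q = q := rfl
  have e1 : (Nat.iterate (fun S : (ℝ × ℝ) ≃ₜ (ℝ × ℝ) ↦ S.trans (rot c)) 1 (Homeomorph.refl _)) q = rot c q := rfl
  have e2 : (Nat.iterate (fun S : (ℝ × ℝ) ≃ₜ (ℝ × ℝ) ↦ S.trans (rot c)) 2 (Homeomorph.refl _)) q = rot c (rot c q) := rfl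
  have e3 : (Nat.iterate (fun S : (ℝ × ℝ) ≃ₜ (ℝ × ℝ) ↦ S.trans (rot c)) 3 (Homeomorph.refl _)) q =
      rot c (rot c (rot c q)) := rfl
  by_cases h0 : c.1 - c.2 < q.1 - q.2
  · exact ⟨0, by norm_num, (mem_sectorChart_source_iff hℓ hm hψ _).2 ⟨hxb, hxc, by rw [e0]; exact h0⟩⟩
  by_cases h1 : c.1 - c.2 < (rot c q).1 - (rot c q).2
  · exact ⟨1, by norm_num, (mem_sectorChart_source_iff hℓ hm hψ _).2 ⟨hxb, hxc, by rw [e1]; exact h1⟩⟩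
  by_cases h2 : c.1 - c.2 < (rot c (rot c q)).1 - (rot c (rot c q)).2
  · exact ⟨2, by norm_num, (mem_sectorChart_source_iff hℓ hm hψ _).2 ⟨hxb, hxc, by rw [e2]; exact h2⟩⟩
  by_cases h3 : c.1 - c.2 < (rot c (rot c (rot c q))).1 - (rot c (rot c (rot c q))).2
  · exact ⟨3, by norm_num, (mem_sectorChart_source_iff hℓ hm hψ _).2 ⟨hxb, hxc, by rw [e3]; exact h3⟩⟩
  -- all four fail: `q = c`
  exfalso
  simp only [rot_apply, not_lt] at h0 h1 h2 h3
  apply hqc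
  ext
  · nlinarith
  · nlinarith

/-! ### Floor apexes -/

/-- Negating the height coordinate. [folklore] -/
def negSnd : (ℝ × ℝ) ≃ₜ (ℝ × ℝ) := (Homeomorph.refl ℝ).prodCongr (Homeomorph.neg ℝ)

/-- The formula for `negSnd`. [folklore] -/
@[simp] theorem negSnd_apply (p : ℝ × ℝ) : negSnd p = (p.1, -p.2) := rfl

/-- **The contour chart of a sector for a floor apex** (`m < ψ` on the boundary): the roof chart
of the negated data followed by the negation of the height coordinate, so that its height
coordinate is again the cone height. [folklore] -/
def floorSectorChart (c : ℝ × ℝ) (ℓ m : ℝ) (ψ : ℝ × ℝ → ℝ) (hℓ : 0 < ℓ) (hm : ∀ q ∈ sphere c ℓ, m < ψ q)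
    (hψ : ContinuousOn ψ (sphere c ℓ)) (T : (ℝ × ℝ) ≃ₜ (ℝ × ℝ)) (hT : IsSquareSymmetry c ℓ T) :
    OpenPartialHomeomorph (ℝ × ℝ) (ℝ × ℝ) :=
  (sectorChart c ℓ (-m) (fun y ↦ -ψ y) hℓ (fun q hq ↦ by linarith [hm q hq]) (hψ.neg) T hT).transHomeomorph negSnd

/-- The source of a floor sector chart. [folklore] -/
theorem floorSectorChart_source (hm' : ∀ q ∈ sphere c ℓ, m < ψ q) (hT : IsSquareSymmetry c ℓ T) :
    (floorSectorChart c ℓ m ψ hℓ hm' hψ T hT).source = T ⁻¹' brSector c ℓ := by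
  rw [floorSectorChart, OpenPartialHomeomorph.transHomeomorph_source, sectorChart_source]

/-- **The height coordinate of a floor sector chart is the cone height.** [folklore] -/
theorem floorSectorChart_snd (hm' : ∀ q ∈ sphere c ℓ, m < ψ q) (hT : IsSquareSymmetry c ℓ T) (x : ℝ × ℝ) :
    (floorSectorChart c ℓ m ψ hℓ hm' hψ T hT x).2 = coneHt c ℓ m ψ x := by
  rw [floorSectorChart, OpenPartialHomeomorph.transHomeomorph_apply, Function.comp_apply, negSnd_apply]
  show -(sectorChart c ℓ (-m) (fun y ↦ -ψ y) hℓ _ _ T hT x).2 = coneHt c ℓ m ψ x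
  rw [sectorChart_snd, coneHt_neg, neg_neg]

/-- **The four floor sector charts cover the punctured open square.** [folklore] -/
theorem exists_mem_floorSectorChart_source (hℓ : 0 < ℓ) (hm' : ∀ q ∈ sphere c ℓ, m < ψ q)
    (hψ : ContinuousOn ψ (sphere c ℓ)) (hxb : x ∈ ball c ℓ) (hxc : x ≠ c) :
    ∃ k < 4, x ∈ (floorSectorChart c ℓ m ψ hℓ hm' hψ _ (isSquareSymmetry_rot_iterate c ℓ k)).source := by
  obtain ⟨k, hk, hmem⟩ := exists_mem_sectorChart_source (m := -m) (ψ := fun y ↦ -ψ y) hℓ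
    (fun q hq ↦ by linarith [hm' q hq]) hψ.neg hxb hxc (c := c)
  refine ⟨k, hk, ?_⟩
  rw [floorSectorChart_source]
  rwa [sectorChart_source] at hmem

end Charts

end ConeSquare

end Literature.Topology.FourManifolds
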